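import Literature.NumberTheory.EllipticCurves.Curve8x121SelmerCertificatesB
import HarnessLib

/-!
# The 8 point classes of `S(-16, -420)` and `dim₂ S(-16, -420) = 5` = `dim₂ S^{(φ)}(X/ℚ)` for `X = [0, 8, 0, 121, 0]`

Topic `NumberTheory/EllipticCurves`. Fourth file of the rank-`1` isogeny-door cell. The classes
`[1, -3, -10, -14, 30, 35, 42, -105]` of `S(-16, -420)` are realised by rational points of `X' = [0, -16, 0, -420, 0]`
(integral points of the quartics `w² = d u⁴ + -16 u²z² + (-420/d) z⁴`); together with the 9 certified classes of
`Curve8x121SelmerCertificatesA`/`…B` this gives `#S(-16, -420) ≥ 17 > 16`, and since `#S = 2^{dim} ≤ 2^{ω(-420)+1} = 32`: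
**`dim₂ S(-16, -420) = 5`** — all `32` classes are everywhere locally soluble. Theorems only.

## References

* [SilvermanAEC2009] J. H. Silverman, *AEC*, 2nd ed.: Prop. X.4.9.
* [SilvermanTate2015] J. H. Silverman, J. Tate, *Rational Points on Elliptic Curves*, §3.5–§3.6.
-/

noncomputable section

open scoped Classical

namespace Literature.NumberTheory.EllipticCurves

namespace Curve8x121

open _root_.WeierstrassCurve _root_.WeierstrassCurve.Affine

/-- `b(a² − 4b) ≠ 0` for `(a, b) = (-16, -420)`. [cite: SilvermanAEC2009, Prop. X.4.9] -/
private theorem hab' : (-420 : ℤ) * ((-16 : ℤ) ^ 2 - 4 * -420) ≠ 0 := by norm_num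

/-- An integral point `f(u, z) = w²` gives a point over every field of characteristic `0`. [folklore] -/
private theorem isSoluble_of_int_point {R : Type*} [Field R] [CharZero R] {d e u z w : ℤ}
    (huz : u ≠ 0 ∨ z ≠ 0) (h : d * u ^ 4 + -16 * u ^ 2 * z ^ 2 + e * z ^ 4 = w ^ 2) :
    ((twoIsogenyQuartic (-16) d e).map (Int.castRingHom R)).IsSoluble := by
  refine ⟨u, z, w, ?_, ?_⟩
  · rcases huz with h | h
    · exact Or.inl (by exact_mod_cast h)
    · exact Or.inr (by exact_mod_cast h)
  · rw [eval_map_twoIsogenyQuartic]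
    simp only [eq_intCast]
    exact_mod_cast h.symm


/-- Squarefreeness of a (small) integer from the factorisation of its absolute value. [folklore] -/
private theorem squarefree_int_of_natAbs {d : ℤ} {n : ℕ} (h : d.natAbs = n) (hn : n ≠ 0)
    (hnd : n.primeFactorsList.Nodup) : Squarefree d :=
  Int.squarefree_natAbs.mp (h ▸ (Nat.squarefree_iff_nodup_primeFactorsList hn).mpr hnd)

/-! ## 1. The 8 point classes of `S(-16, -420)` and `dim₂ S(-16, -420) = 5` -/

/-- `1 ∈ S(-16, -420)` (the class of `O`). [cite: SilvermanAEC2009, Prop. X.4.9] -/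
theorem mem_S_1 : (1 : ℤ) ∈ twoIsogenySelmerGroup (-16) (-420) := one_mem_twoIsogenySelmerGroup (-16) (by norm_num)

/-- `-3 ∈ S(-16, -420)`: the class of the rational point `((-3), (-33))` of `X'`, i.e. the integral point
`(1, 1, 11)` of `w² = -3u⁴ + -16u²z² + (140)z⁴`. [cite: SilvermanAEC2009, Prop. X.4.9] -/
theorem mem_S_m3 : (-3 : ℤ) ∈ twoIsogenySelmerGroup (-16) (-420) :=
  (mem_twoIsogenySelmerGroup_iff (by norm_num)).mpr
    ⟨squarefree_int_of_natAbs (n := 3) rfl (by norm_num) (by simp), by norm_num, by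
      rw [show (-420 : ℤ) / -3 = 140 by norm_num]
      exact ⟨isSoluble_of_int_point (u := 1) (z := 1) (w := 11) (Or.inl (by norm_num)) (by norm_num),
        fun p _ => isSoluble_of_int_point (u := 1) (z := 1) (w := 11) (Or.inl (by norm_num)) (by norm_num)⟩⟩

/-- `-10 ∈ S(-16, -420)`: the class of the rational point `((-10), (-40))` of `X'`, i.e. the integral point
`(1, 1, 4)` of `w² = -10u⁴ + -16u²z² + (42)z⁴`. [cite: SilvermanAEC2009, Prop. X.4.9] -/
theorem mem_S_m10 : (-10 : ℤ) ∈ twoIsogenySelmerGroup (-16) (-420) :=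
  (mem_twoIsogenySelmerGroup_iff (by norm_num)).mpr
    ⟨squarefree_int_of_natAbs (n := 10) rfl (by norm_num) (by simp), by norm_num, by
      rw [show (-420 : ℤ) / -10 = 42 by norm_num]
      exact ⟨isSoluble_of_int_point (u := 1) (z := 1) (w := 4) (Or.inl (by norm_num)) (by norm_num),
        fun p _ => isSoluble_of_int_point (u := 1) (z := 1) (w := 4) (Or.inl (by norm_num)) (by norm_num)⟩⟩

/-- `-14 ∈ S(-16, -420)`: the class of the rational point `((-14), 0)` of `X'`, i.e. the integral point
`(1, 1, 0)` of `w² = -14u⁴ + -16u²z² + (30)z⁴`. [cite: SilvermanAEC2009, Prop. X.4.9] -/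
theorem mem_S_m14 : (-14 : ℤ) ∈ twoIsogenySelmerGroup (-16) (-420) :=
  (mem_twoIsogenySelmerGroup_iff (by norm_num)).mpr
    ⟨squarefree_int_of_natAbs (n := 14) rfl (by norm_num) (by simp), by norm_num, by
      rw [show (-420 : ℤ) / -14 = 30 by norm_num]
      exact ⟨isSoluble_of_int_point (u := 1) (z := 1) (w := 0) (Or.inl (by norm_num)) (by norm_num),
        fun p _ => isSoluble_of_int_point (u := 1) (z := 1) (w := 0) (Or.inl (by norm_num)) (by norm_num)⟩⟩

/-- `30 ∈ S(-16, -420)`: the class of the rational point `(30, 0)` of `X'`, i.e. the integral point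
`(1, 1, 0)` of `w² = 30u⁴ + -16u²z² + (-14)z⁴`. [cite: SilvermanAEC2009, Prop. X.4.9] -/
theorem mem_S_30 : (30 : ℤ) ∈ twoIsogenySelmerGroup (-16) (-420) :=
  (mem_twoIsogenySelmerGroup_iff (by norm_num)).mpr
    ⟨squarefree_int_of_natAbs (n := 30) rfl (by norm_num) (by simp), by norm_num, by
      rw [show (-420 : ℤ) / 30 = -14 by norm_num]
      exact ⟨isSoluble_of_int_point (u := 1) (z := 1) (w := 0) (Or.inl (by norm_num)) (by norm_num),
        fun p _ => isSoluble_of_int_point (u := 1) (z := 1) (w := 0) (Or.inl (by norm_num)) (by norm_num)⟩⟩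

/-- `35 ∈ S(-16, -420)`: the class of the rational point `(140, (-1540))` of `X'`, i.e. the integral point
`(2, 1, 22)` of `w² = 35u⁴ + -16u²z² + (-12)z⁴`. [cite: SilvermanAEC2009, Prop. X.4.9] -/
theorem mem_S_35 : (35 : ℤ) ∈ twoIsogenySelmerGroup (-16) (-420) :=
  (mem_twoIsogenySelmerGroup_iff (by norm_num)).mpr
    ⟨squarefree_int_of_natAbs (n := 35) rfl (by norm_num) (by simp), by norm_num, by
      rw [show (-420 : ℤ) / 35 = -12 by norm_num]
      exact ⟨isSoluble_of_int_point (u := 2) (z := 1) (w := 22) (Or.inl (by norm_num)) (by norm_num),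
        fun p _ => isSoluble_of_int_point (u := 2) (z := 1) (w := 22) (Or.inl (by norm_num)) (by norm_num)⟩⟩

/-- `42 ∈ S(-16, -420)`: the class of the rational point `(42, (-168))` of `X'`, i.e. the integral point
`(1, 1, 4)` of `w² = 42u⁴ + -16u²z² + (-10)z⁴`. [cite: SilvermanAEC2009, Prop. X.4.9] -/
theorem mem_S_42 : (42 : ℤ) ∈ twoIsogenySelmerGroup (-16) (-420) :=
  (mem_twoIsogenySelmerGroup_iff (by norm_num)).mpr
    ⟨squarefree_int_of_natAbs (n := 42) rfl (by norm_num) (by simp), by norm_num, by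
      rw [show (-420 : ℤ) / 42 = -10 by norm_num]
      exact ⟨isSoluble_of_int_point (u := 1) (z := 1) (w := 4) (Or.inl (by norm_num)) (by norm_num),
        fun p _ => isSoluble_of_int_point (u := 1) (z := 1) (w := 4) (Or.inl (by norm_num)) (by norm_num)⟩⟩

/-- `-105 ∈ S(-16, -420)` (the class `[-420] = [-105]` of `T' = (0,0)`). [cite: SilvermanAEC2009, Prop. X.4.9] -/
theorem mem_S_m105 : (-105 : ℤ) ∈ twoIsogenySelmerGroup (-16) (-420) :=
  mem_twoIsogenySelmerGroup_of_isSquare (by norm_num)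
    (squarefree_int_of_natAbs (n := 105) rfl (by norm_num) (by simp)) (by norm_num) ⟨2, by norm_num⟩

/-- **`#S(-16, -420) ≥ 17`**: the 8 point classes and the 9 certified classes of `Curve8x121SelmerAll`.
[cite: SilvermanAEC2009, Prop. X.4.9] -/
theorem card_twoIsogenySelmerGroup_ge : 17 ≤ (twoIsogenySelmerGroup (-16) (-420)).card := by
  calc 17 = ({1, -3, -10, -14, 30, 35, 42, -105, -1, 2, -2, 3, 5, -5, 6, -6, 7} : Finset ℤ).card := by decide
    _ ≤ (twoIsogenySelmerGroup (-16) (-420)).card := by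
      refine Finset.card_le_card ?_
      intro d hd
      simp only [Finset.mem_insert, Finset.mem_singleton] at hd
      rcases hd with rfl | rfl | rfl | rfl | rfl | rfl | rfl | rfl | rfl | rfl | rfl | rfl | rfl | rfl | rfl | rfl | rfl
      · exact mem_S_1
      · exact mem_S_m3
      · exact mem_S_m10
      · exact mem_S_m14
      · exact mem_S_30
      · exact mem_S_35
      · exact mem_S_42
      · exact mem_S_m105
      · exact mem_S_m1
      · exact mem_S_2
      · exact mem_S_m2
      · exact mem_S_3
      · exact mem_S_5
      · exact mem_S_m5
      · exact mem_S_6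
      · exact mem_S_m6
      · exact mem_S_7

/-- **`dim₂ S(-16, -420) = 5`**: `2^{dim} = #S` lies between `17` and `2^{ω(-420)+1} = 32`: all `32` classes are everywhere
locally soluble. [cite: SilvermanAEC2009, Prop. X.4.9] -/
theorem twoIsogenySelmerRank_X' : twoIsogenySelmerRank (-16) (-420) = 5 := by
  have hle : twoIsogenySelmerRank (-16) (-420) ≤ 5 := by
    have h := twoIsogenySelmerRank_le (-16) (b := -420) (by norm_num)
    have h3 : (-420 : ℤ).natAbs.primeFactors.card = 4 := by decide +kernel
    omega
  have hge : 17 ≤ 2 ^ twoIsogenySelmerRank (-16) (-420) := by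
    rw [two_pow_twoIsogenySelmerRank_eq_card hab']
    exact card_twoIsogenySelmerGroup_ge
  interval_cases (twoIsogenySelmerRank (-16) (-420)) <;> simp_all

/-- `dim₂ S'(8, 121) = dim₂ S(-16, -420) = 5`. [cite: SilvermanAEC2009, Prop. X.4.9] -/
theorem twoIsogenySelmerRank'_X : twoIsogenySelmerRank' (8) 121 = 5 := by
  rw [twoIsogenySelmerRank', show (-2 * (8) : ℤ) = -16 by norm_num, show ((8 : ℤ) ^ 2 - 4 * 121 : ℤ) = -420 by norm_num]
  exact twoIsogenySelmerRank_X'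


end Curve8x121

end Literature.NumberTheory.EllipticCurves

end
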